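import Literature.NumberTheory.LFunctions.SalemIntegralEquationProofs
import HarnessLib

/-!
# RH-EQUIVALENT · González–Negrín: RH ⟺ for `1/2 < δ < 1` Salem's integral equation `∫₀^∞ t^{δ−1} f(t) dt/(e^{xt}+1) = 0` (all `x > 0`) has no solution of the form `f(t) = t^{iγ}` — PROVED; nothing here bears on the truth of RH

B. J. González, E. R. Negrín, *A new equivalence to the Riemann Hypothesis by means of the Salem
integral equation*, arXiv:2604.15396 (2026), 2 pp. Salem (1953) proved: RH ⟺ for each
`1/2 < δ < 1` the only bounded measurable `f` on `(0,∞)` with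
`∫₀^∞ t^{δ−1} f(t) dt/(e^{xt}+1) = 0` for all `x > 0` is `f = 0` a.e. (the tree's
`Salem1953_criterion_holds`, additive form `y = −log t`). The note observes that RH is ALREADY
equivalent to the absence of the special solutions `f(t) = t^{iγ}`, `γ ∈ ℝ`: since
`∫₀^∞ t^{s−1} dt/(e^{xt}+1) = x^{−s} Γ(s) η(s)` for `Re s > 0`, `x > 0`
(`η(s) = (1 − 2^{1−s}) ζ(s)`), `s = δ + iγ` with `0 < δ < 1` is a zero of `ζ` iff `t^{iγ}` solves the
equation at abscissa `δ`; the symmetry of the zeros about `Re s = 1/2` then restricts to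
`1/2 < δ < 1`.

This file PROVES the equivalence exactly as printed, from the tree's
`mellin_fermiDirac_eq` (`∫₀^∞ v^{s−1} dv/(e^v+1) = Γ(s)(1−2^{1−s})ζ(s)`, `Re s > 0`, `s ≠ 1`;
`SalemIntegralEquationProofs.lean`) and Mathlib's `mellin_comp_mul_left` (the scaling `x^{−s}`):

* `GonzalezNegrin.integral_eq` — the displayed identity
  `∫₀^∞ t^{δ−1} t^{iγ} dt/(e^{xt}+1) = x^{−s} Γ(s)(1−2^{1−s})ζ(s)`, `s = δ+iγ`, `0 < δ < 1`, `x > 0`;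
* `GonzalezNegrin.forall_integral_eq_zero_iff` — "`s = δ + iγ` is a zero of `ζ` iff `t^{iγ}` is a
  solution for all `x > 0`" (`0 < δ < 1`);
* `GonzalezNegrin2026_equivalence` — the note's theorem (RH ⟺ no power solutions for
  `1/2 < δ < 1`), and `GonzalezNegrin2026_equivalence_strip` — the intermediate form printed first
  (`0 < δ < 1`, `δ ≠ 1/2`).

HONESTY LABEL (column rule §5.6, "is this RH re-indexed?"): yes — each zero `ρ = δ + iγ` of `ζ` in
the strip corresponds to exactly one power solution `t^{iγ}` at abscissa `δ`, so the right-hand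
side is the zero-free region restated through the Mellin identity; the note is recorded and
kernel-checked as such (RH-EQUIVALENT, re-indexing class). No definitions, no named facts.
Nothing here bears on the truth of RH.

## References

* B. J. González, E. R. Negrín, *A new equivalence to the Riemann Hypothesis by means of the Salem
  integral equation*, arXiv:2604.15396 (2026), §2 "Proof of the new equivalence" (the displayed
  Mellin identity, the strip form, the final form) [GonzalezNegrin2026].
* R. Salem, C. R. Acad. Sci. Paris 236 (1953) 1127–1128 [Salem1953].
* E. C. Titchmarsh, *The Theory of the Riemann Zeta-Function*, 2nd ed., §2.5 Thm 2.5
  (`Γ(s)η(s) = ∫₀^∞ x^{s−1} dx/(e^x+1)`, `σ > 0`) [Titchmarsh1986].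
-/

noncomputable section

open MeasureTheory Set Filter Complex

namespace Literature.NumberTheory.LFunctions

namespace GonzalezNegrin

/-- The integrand of the note's equation tested on `f(t) = t^{iγ}` is the Mellin integrand of the
scaled Fermi–Dirac kernel at `s = δ + iγ`: for `t > 0`,
`t^{δ−1} · (e^{xt}+1)^{−1} · t^{iγ} = t^{s−1} • (e^{xt}+1)^{−1}`.
[cite: GonzalezNegrin2026, §2 (the displayed identity for ∫₀^∞ t^{s−1} dt/(e^{xt}+1))] -/
theorem integrand_eq {δ γ x t : ℝ} (ht : 0 < t) :
    (t : ℂ) ^ ((δ : ℂ) - 1) / (((Real.exp (x * t) + 1 : ℝ) : ℂ)) * (t : ℂ) ^ ((γ : ℂ) * I) =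
      (t : ℂ) ^ (((δ : ℂ) + (γ : ℂ) * I) - 1) • (((Real.exp (x * t) + 1 : ℝ) : ℂ))⁻¹ := by
  have ht' : (t : ℂ) ≠ 0 := ofReal_ne_zero.2 ht.ne'
  rw [smul_eq_mul, show ((δ : ℂ) + (γ : ℂ) * I) - 1 = ((δ : ℂ) - 1) + (γ : ℂ) * I by ring,
    cpow_add _ _ ht', div_eq_mul_inv]
  ring

/-- **The displayed identity of the note**: for `x > 0` and `0 < δ` with `δ + iγ ≠ 1`,
`∫₀^∞ t^{δ−1} t^{iγ} dt/(e^{xt}+1) = x^{−s} Γ(s) (1 − 2^{1−s}) ζ(s)`, `s = δ + iγ` (the tree's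
`mellin_fermiDirac_eq` scaled by Mathlib's `mellin_comp_mul_left`).
[cite: GonzalezNegrin2026, §2 (∫₀^∞ t^{s−1}/(e^{xt}+1) dt = x^{−s} Γ(s) η(s), Re s > 0)] -/
theorem integral_eq {δ γ x : ℝ} (hx : 0 < x) (hδ : 0 < δ) (h1 : (δ : ℂ) + (γ : ℂ) * I ≠ 1) :
    ∫ t in Ioi (0 : ℝ), (t : ℂ) ^ ((δ : ℂ) - 1) / (((Real.exp (x * t) + 1 : ℝ) : ℂ)) *
        (t : ℂ) ^ ((γ : ℂ) * I) =
      (x : ℂ) ^ (-((δ : ℂ) + (γ : ℂ) * I)) *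
        (Gamma ((δ : ℂ) + (γ : ℂ) * I) *
          ((1 - 2 ^ (1 - ((δ : ℂ) + (γ : ℂ) * I))) * riemannZeta ((δ : ℂ) + (γ : ℂ) * I))) := by
  set s : ℂ := (δ : ℂ) + (γ : ℂ) * I with hs
  have hre : s.re = δ := by simp [hs]
  have hmel : mellin (fun t : ℝ ↦ (((Real.exp (x * t) + 1 : ℝ) : ℂ))⁻¹) s =
      (x : ℂ) ^ (-s) * (Gamma s * ((1 - 2 ^ (1 - s)) * riemannZeta s)) := by
    have h := mellin_comp_mul_left (fun v : ℝ ↦ (((Real.exp v + 1 : ℝ) : ℂ))⁻¹) s hx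
    rw [smul_eq_mul, mellin_fermiDirac_eq (by rw [hre]; exact hδ) h1] at h
    exact h
  rw [← hmel, mellin]
  exact setIntegral_congr_fun measurableSet_Ioi fun t ht ↦ integrand_eq ht

/-- `1 − 2^{1−s} ≠ 0` for `Re s < 1` (`|2^{1−s}| = 2^{1−Re s} > 1`).
[cite: GonzalezNegrin2026, §2 ("η(s) = (1 − 2^{1−s}) ζ(s) … extends ζ(s) to 0 < Re s < 1")] -/
theorem one_sub_two_cpow_ne_zero {s : ℂ} (hs : s.re < 1) : (1 : ℂ) - 2 ^ (1 - s) ≠ 0 := by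
  intro h
  have h' : (2 : ℂ) ^ (1 - s) = 1 := (sub_eq_zero.1 h).symm
  have hn : ‖(2 : ℂ) ^ (1 - s)‖ = (2 : ℝ) ^ (1 - s.re) := by
    rw [show (2 : ℂ) = ((2 : ℝ) : ℂ) by norm_num, Complex.norm_cpow_eq_rpow_re_of_pos two_pos]
    simp
  rw [h', norm_one] at hn
  have : (1 : ℝ) < (2 : ℝ) ^ (1 - s.re) := Real.one_lt_rpow one_lt_two (by linarith)
  linarith

/-- **"`s = δ + iγ`, `0 < δ < 1`, is a zero of `ζ` iff `t^{iγ}` solves the equation for all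
`x > 0`"** (the note's central observation). [cite: GonzalezNegrin2026, §2 ("we obtain that s = δ + iγ, 0 < δ < 1, is a zero of ξ(s) if and only if …")] -/
theorem forall_integral_eq_zero_iff {δ γ : ℝ} (hδ : 0 < δ) (hδ1 : δ < 1) :
    (∀ x : ℝ, 0 < x →
        ∫ t in Ioi (0 : ℝ), (t : ℂ) ^ ((δ : ℂ) - 1) / (((Real.exp (x * t) + 1 : ℝ) : ℂ)) *
          (t : ℂ) ^ ((γ : ℂ) * I) = 0) ↔
      riemannZeta ((δ : ℂ) + (γ : ℂ) * I) = 0 := by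
  set s : ℂ := (δ : ℂ) + (γ : ℂ) * I with hs
  have hre : s.re = δ := by simp [hs]
  have h1 : s ≠ 1 := fun h ↦ by
    have := congrArg re h
    rw [hre, one_re] at this
    linarith
  have hΓ : Gamma s ≠ 0 := Gamma_ne_zero_of_re_pos (by rw [hre]; exact hδ)
  have h2 : (1 : ℂ) - 2 ^ (1 - s) ≠ 0 := one_sub_two_cpow_ne_zero (by rw [hre]; exact hδ1)
  constructor
  · intro h
    have h0 := h 1 one_pos
    rw [integral_eq one_pos hδ h1, ofReal_one, one_cpow, one_mul] at h0
    rcases mul_eq_zero.1 h0 with hG | hrest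
    · exact (hΓ hG).elim
    · rcases mul_eq_zero.1 hrest with h2' | hζ
      · exact (h2 h2').elim
      · exact hζ
  · intro hζ x hx
    rw [integral_eq hx hδ h1, hζ, mul_zero, mul_zero, mul_zero]

end GonzalezNegrin

open GonzalezNegrin

/-- **González–Negrín, intermediate form** ("Therefore, the Riemann Hypothesis is true if and only
if for each `0 < δ < 1`, `δ ≠ 1/2`, the integral equation … has no solutions of type
`f(t) = t^{iγ}`"). RH-EQUIVALENT (re-indexing of the zero set).
[cite: GonzalezNegrin2026, §2 (the form with 0 < δ < 1, δ ≠ 1/2)] -/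
theorem GonzalezNegrin2026_equivalence_strip :
    RiemannHypothesis ↔
      ∀ δ : ℝ, 0 < δ → δ < 1 → δ ≠ 1 / 2 → ∀ γ : ℝ,
        ¬ (∀ x : ℝ, 0 < x →
            ∫ t in Ioi (0 : ℝ), (t : ℂ) ^ ((δ : ℂ) - 1) / (((Real.exp (x * t) + 1 : ℝ) : ℂ)) *
              (t : ℂ) ^ ((γ : ℂ) * I) = 0) := by
  constructor
  · intro hRH δ hδ hδ1 hδh γ hsol
    have hζ := (forall_integral_eq_zero_iff hδ hδ1).1 hsol
    have hstrip := riemannHypothesis_iff_strip_holds.1 hRH ((δ : ℂ) + (γ : ℂ) * I) hζ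
      (by simp; exact hδ) (by simp; exact hδ1)
    have hstrip' : δ = 1 / 2 := by simpa using hstrip
    exact hδh hstrip'
  · intro h
    refine riemannHypothesis_iff_strip_holds.2 fun s hζ h0 h1 ↦ ?_
    by_contra hne
    have hs : ((s.re : ℝ) : ℂ) + ((s.im : ℝ) : ℂ) * I = s := re_add_im s
    refine h s.re h0 h1 hne s.im ((forall_integral_eq_zero_iff h0 h1).2 ?_)
    rw [hs]; exact hζ

/-- **González–Negrín's equivalence** ("The Riemann Hypothesis is true if and only if for each
`1/2 < δ < 1` the integral equation `∫₀^∞ t^{δ−1} f(t) dt/(e^{xt}+1) = 0`, for all `x > 0`, has no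
solutions of type `f(t) = t^{iγ}`, `t ∈ (0,∞)`, `γ ∈ ℝ`"). RH-EQUIVALENT (re-indexing of the zero
set: the power solutions at abscissa `δ` are exactly the zeros `δ + iγ`; compare the tree's full
`Salem1953_criterion_holds`). [cite: GonzalezNegrin2026, §2 (final equivalence, 1/2 < δ < 1)] -/
theorem GonzalezNegrin2026_equivalence :
    RiemannHypothesis ↔
      ∀ δ : ℝ, 1 / 2 < δ → δ < 1 → ∀ γ : ℝ,
        ¬ (∀ x : ℝ, 0 < x →
            ∫ t in Ioi (0 : ℝ), (t : ℂ) ^ ((δ : ℂ) - 1) / (((Real.exp (x * t) + 1 : ℝ) : ℂ)) *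
              (t : ℂ) ^ ((γ : ℂ) * I) = 0) := by
  constructor
  · intro hRH δ hδ hδ1 γ
    exact GonzalezNegrin2026_equivalence_strip.1 hRH δ (by linarith) hδ1 (by linarith) γ
  · intro h
    refine quasiRiemannHypothesis_one_half_iff_holds.1 fun s hζ h0 h1 ↦ ?_
    have hs : ((s.re : ℝ) : ℂ) + ((s.im : ℝ) : ℂ) * I = s := re_add_im s
    refine h s.re h0 h1 s.im ((forall_integral_eq_zero_iff (by linarith) h1).2 ?_)
    rw [hs]; exact hζ

end Literature.NumberTheory.LFunctions

end
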